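import Literature.NumberTheory.LFunctions.MertensSecondChainCheck
import HarnessLib

/-!
# RH-FREE kernel certificate — «nothing here bears on the truth of RH»
# The error term of Mertens' second theorem is positive below `358 811`: certified run

Topic: `Literature/NumberTheory/LFunctions`. Pure proof file (kernel computations; nothing is asserted, no
definition). `run1`/`run2` evaluate `MertensSecondChain.runD 15333` — at most `15333` steps of the `E₂`-chain of
`MertensSecondChainCheck.lean` along the prime table `ChainTable.table`, each certifying the primality of the
next entry `p'`, extending the enclosures of `log p'` and `log log p'`, and performing the comparison
`MHI + LL(p') ≤ S(p)` behind `Σ_{q ≤ x} 1/q − log log x − B > 0` on `[p, p')` — from the state at the prime `3`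
(`MertensSecondChain.initE`) to the prime `167953`, and on to the prime `358811`; `runA_eq` evaluates the
two-sided accumulation `MertensSecondChain.runDA 3244` of `2⁸⁰ Σ_{3 ≤ q ≤ 30011} (log(1 + 1/(q−1)) − 1/q)` behind
the bound `B < MHI/2⁸⁰` for the Meissel–Mertens constant. The meaning of these states is supplied by
`MertensSecondChainSound.lean`; the expected values were obtained by evaluating the same functions compiled.
`decide +kernel`, standard axioms only (`maxHeartbeats 0` for these declarations).

## References

* J. B. Rosser, L. Schoenfeld, Illinois J. Math. 6 (1962), 64–94, Thms 20–21 and p. 87 (`E₂ > 0` below `10⁸`).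
  [RosserSchoenfeld1962]
* T. Zhao, Res. Number Theory 11 (2025) 62, §1.1 and §2 («`E_i(x) > 0` for `2 ≤ x ≤ 10⁸`»). [Zhao2025MertensMean]
-/

namespace Literature.NumberTheory.LFunctions.MertensSecondChainRun

open MertensSecondChain

set_option maxHeartbeats 0 in
/-- **Chunk 1 of the certified `E₂`-run** (primes `3` to `167953`). [cite: Zhao2025MertensMean, §1.1 («E_i(x) > 0 for 2 ≤ x ≤ 10⁸» [RS])] -/
theorem run1 :
    runD 15333 initE =
    some ⟨167953, 14545117807108278801555194, 14545117807108754407928708,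
        3007230998018183245836188, 3323552157583063708671948⟩ := by
  decide +kernel

set_option maxHeartbeats 0 in
/-- **Chunk 2 of the certified `E₂`-run** (primes `167953` to `358811`). [cite: Zhao2025MertensMean, §1.1 («E_i(x) > 0 for 2 ≤ x ≤ 10⁸» [RS])] -/
theorem run2 :
    runD 15333
      ⟨167953, 14545117807108278801555194, 14545117807108754407928708,
        3007230998018183245836188, 3323552157583063708671948⟩ =
    some ⟨358811, 15462827431324419163683070, 15462827431324894770484816,
        3081197337989921023099944, 3397543217224910529610992⟩ := by
  decide +kernel

set_option maxHeartbeats 0 in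
/-- **The certified accumulation for the Meissel–Mertens constant** (primes `3` to `30011`).
[cite: RosserSchoenfeld1962, (2.10) (B = 0.26149 72128…)] -/
theorem runA_eq :
    runDA 3244 initA = some ⟨30011, 148177783098089907964255, 148177783098089908070320⟩ := by
  decide +kernel

end Literature.NumberTheory.LFunctions.MertensSecondChainRun
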